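import Summits.BirchSwinnertonDyer.BirchSwinnertonDyer.Theorems.GenusKolyvaginAtTwoPowDvdShaCardAtTwoRTCrossPairShaTorsion
import Summits.BirchSwinnertonDyer.BirchSwinnertonDyer.Theorems.GenusKolyvaginAtTwoShaCardDvdPowAtTwoRTBottomLayerLocalVanishing
import HarnessLib

/-!
# Route `GenusKolyvaginAtTwo`, crux U_T `ShaCardDvdPowAtTwoRT` (stmt-BirchSwinnertonDyer-23298; upper half
# `#Ш(E/K)[2^∞] ∣ 2^(2M₀)`) — THE BOTTOM LAYER FROM `ℚ` IS CASSELS–TATE ORTHOGONAL TO EVERY KOLYVAGIN-PROVENANCE CLASS: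
# `B(x, y) = 0` for `x ∈ Ш(E/K)[m]` over a Selmer class `z = m·k·c` with own places at deep inert Kolyvagin primes and ANY
# `y ∈ Ш(E/K)[m]` whose level-`m²` Selmer lift `t` is `τ`-INVARIANT and `2`-TORSION

Seat `bsd-line-gk2-p3` g25 (PROVER seat 3/3, cell `bsd-f1-sign2`), `--supports stmt-BirchSwinnertonDyer-23298` (helper; closes nothing).
THEOREMS ONLY (no definition, no named fact, no `sorry`); follows gk2-p4 g20's road-(E4) files `…RTCrossSignLocalVanishing` /
`…RTCrossPairVanishing` / `…RTCrossPairTerm` / `…RTCrossPairShaTorsion` (p736279, p737872, p737900, p738908) line by line, replacing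
«opposite signs» by «`τ`-fixed and `2`-torsion».  BSD is NOT proved by any of this; neither is U_T, L_T nor any stub.

WHY (seat memo `Cruxes/ShaCardDvdPowAtTwoRT/Lines/norm-sharp-upper-gk2p3.md` §3, the kernel form of its finding).  McCallum's Prop. 4.7
writes the level-`m` Cassels–Tate value `B(x, y)` of `x = ι(m·b₁)` against `y` as the sum over the own places `λ` of `b₁` of local terms
`inv_λ(loc_λ b₁ ∪ₑ β′_λ)`, `β′_λ ∈ 𝓛_λ^{(m²)}` a Kummer lift of the level-`m` class `b′` of `y`.  If `y` lies in the BOTTOM LAYER FROM `ℚ`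
— its lift `t = ι_* b′ ∈ Sel^{(m²)}(E/K)` is `τ`-invariant and `2`-torsion — then `β′_λ` is `τ`-fixed and `2`-torsion MODULO `m·𝓛_λ`
(`[m]_*` kills `σ_*β′_λ − β′_λ` and `2β′_λ`; `ker [m]_* ∩ 𝓛 = m·𝓛`, gk2-p4's `…RTKummerLevelKernel` / `…RTCrossPairNaturality`), and on the
REGULAR frame at a deep inert Kolyvagin place (`E[m²] = E[2^M]` free of rank one over `ℤ/2^M[τ̃_*]`, `Δ < 0`) such a Kummer class pairs to
ZERO with every eigen local class killed by `m` (companion file: in coordinates `β′ = a·a₀ + b·τa₀` with `b ≡ a (mod m)` and `m ∣ 2a`, so the norm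
coefficient `a ± b` is `≡ 0 (mod m)`).  Hence every local term vanishes and **`B(x, y) = 0`** (§5).  Consequence for U_T: the `(+)`- and
`(−)`-provenance Kolyvagin spans of LINE 18 (road (E4)) are BOTH orthogonal to
`Z₀ = {y ∈ Ш[2] : y has a τ-invariant Selmer lift}` (⊇ the image of `Ш(E/ℚ)[2]`), so by non-degeneracy they lie in `Z₀^⊥`: McCallum's
Thm. 5.4 / 5.8 certificates over `K` can never generate the dual of a maximal isotropic subgroup meeting `Z₀` — the `K`-frame of Kolyvagin's
descent is blind to the bottom layer from `ℚ` (memo §3–§4: the bit is recoverable only over `ℚ`, at the price of the transposition primes).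

* §1–§3 (the local law: abstract / displayed structure / assembled at a deep inert Kolyvagin place) are the companion file
  `…ShaCardDvdPowAtTwoRTBottomLayerLocalVanishing` (`invWeilPairing_kummer_localization_eq_zero_of_conjActPlace_sub_eq_zsmul_of_two_smul(_of_level_eq)`).
* §4 `firstCase_localTerm_eq_zero_of_bottomLayer(_of_conjAct_eq)(_inclKD)` — the LOCAL TERM of McCallum's Prop. 4.7 at an own place of the
  first class vanishes when the second class is `τ`-invariant `2`-torsion (`exists_mem_kummer_two_smul_eq_zsmul`: `2β′_λ = m·Y₂`).
* §5 **`ctLevelPairing_eq_zero_of_bottomLayer`** — `B(x, y) = 0`, `ι`-free (as `ctLevelPairing_eq_zero_of_opposite_signs`, with the second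
  class `τ`-invariant `2`-torsion instead of opposite-sign, and no own places of `t`).

References: [McCallumLMS1991] §4 Prop. 4.7, §5 Lemma 5.3, Thm. 5.4 (16)–(23), Thm. 5.8; [MilneADT2006] I §6 proof of Prop. 6.9, I Cor. 2.3;
[GrossLMS1991] Prop. 5.4, §8 Prop. 8.2; [Kolyvagin1991StructureSha]; [Kramer1981] Prop. 3 (the norm index at a ramified place).
-/

set_option autoImplicit false

noncomputable section

open scoped Classical
open scoped AddSubgroup
open Function Field NumberField IsDedekindDomain WeierstrassCurve
open Literature.NumberTheory.EllipticCurves Literature.NumberTheory.GaloisRepresentations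
open Literature.NumberTheory.GaloisCohomology
open Literature.NumberTheory.Automorphic
open Summit.BirchSwinnertonDyer.Rank1Residual.X11b.Relaxation
open Summit.BirchSwinnertonDyer.Rank1Residual.JET.GlobalDuality

-- the Theorems namespace of this sub repeats the summit name by design (D-0017 nested layout)
set_option linter.dupNamespace false

namespace Summit.BirchSwinnertonDyer.BirchSwinnertonDyer.Theorems.GenusExact.PlusDescent

section Kolyvagin

variable (W : WeierstrassCurve ℚ) (K : Type) [Field K] [NumberField K] [W.IsElliptic] [W.IsGloballyMinimal]

/-! ## §4 The local term of McCallum's Prop. 4.7 at an own place of the first class, second class in the bottom layer -/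

omit [W.IsGloballyMinimal] in
/-- **The Kummer lift of a `2`-torsion Selmer class is `2`-torsion modulo `m·𝓛`.**  For a first-case datum `D` at level `m` over the Heegner field
whose second class satisfies `2·b′ = 0`, at a finite place `λ`: `2β′_λ = m·Y₂` with `Y₂ ∈ 𝓛_λ^{(m²)}` (`[m]_*(2β′_λ) = 2 loc_λ b′ = 0`, and
`ker [m]_* ∩ 𝓛 = m·𝓛`, gk2-p4's `…RTKummerLevelKernel`). [cite: McCallumLMS1991, §4 Prop. 4.7] [cite: MilneADT2006, Ch. I §6, proof of Prop. 6.9] -/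
theorem exists_mem_kummer_two_smul_eq_zsmul {m : ℕ} [NeZero m] (w : HeightOneSpectrum (𝓞 K))
    (D : FirstCaseData (W.baseChange K) m) (hb' : (2 : ℤ) • D.b' = 0)
    (βw : galoisCohomology (((W.baseChange K).torsionGaloisModule ((m * m : ℕ) : ℤ)).toLocal (Sum.inr w : Place K)) 1)
    (hβw : βw = D.β' (Sum.inr w)) :
    ∃ Y₂ : galoisCohomology (((W.baseChange K).torsionGaloisModule ((m * m : ℕ) : ℤ)).toLocal (Sum.inr w : Place K)) 1,
      Y₂ ∈ (W.baseChange K).kummerSelmerStructure ((m * m : ℕ) : ℤ) (Sum.inr w) ∧ (2 : ℤ) • βw = (m : ℤ) • Y₂ := by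
  have hβmem : βw ∈ (W.baseChange K).kummerSelmerStructure ((m * m : ℕ) : ℤ) (Sum.inr w) := hβw ▸ D.β'_mem (Sum.inr w)
  have hmap : galoisCohomology.map ((mulK (W.baseChange K) m m).restrictField (Place.Completion (Sum.inr w : Place K))) 1 βw =
      galoisCohomology.localization ((W.baseChange K).torsionGaloisModule (m : ℤ)) (Sum.inr w : Place K) 1 D.b' := by
    rw [hβw]; exact D.map_β' (Sum.inr w)
  have hker : (galoisCohomology.map ((mulK (W.baseChange K) m m).restrictField (Place.Completion (Sum.inr w : Place K))) 1 :
        galoisCohomology (((W.baseChange K).torsionGaloisModule ((m * m : ℕ) : ℤ)).toLocal (Sum.inr w : Place K)) 1 →+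
          galoisCohomology (((W.baseChange K).torsionGaloisModule (m : ℤ)).toLocal (Sum.inr w : Place K)) 1)
      ((2 : ℤ) • βw) = 0 := by
    set F : galoisCohomology (((W.baseChange K).torsionGaloisModule ((m * m : ℕ) : ℤ)).toLocal (Sum.inr w : Place K)) 1 →+
        galoisCohomology (((W.baseChange K).torsionGaloisModule (m : ℤ)).toLocal (Sum.inr w : Place K)) 1 :=
      galoisCohomology.map ((mulK (W.baseChange K) m m).restrictField (Place.Completion (Sum.inr w : Place K))) 1 with hF
    have hmapF : F βw = galoisCohomology.localization ((W.baseChange K).torsionGaloisModule (m : ℤ)) (Sum.inr w : Place K) 1 D.b' :=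
      hmap
    have e2 : F ((2 : ℤ) • βw) = (2 : ℤ) • F βw := map_zsmul F 2 βw
    have hF0 : F ((2 : ℤ) • βw) = 0 := by rw [e2, hmapF, ← map_zsmul, hb', map_zero]
    exact hF0
  have hmem : (2 : ℤ) • βw ∈ (W.baseChange K).kummerSelmerStructure ((m * m : ℕ) : ℤ) (Sum.inr w) := AddSubgroup.zsmul_mem _ hβmem _
  obtain ⟨Y₂, hY₂, hEq⟩ := exists_eq_zsmul_of_mem_kummer_of_map_mulK_eq_zero (W.baseChange K) (Place.Completion (Sum.inr w : Place K)) m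
    hmem hker
  exact ⟨Y₂, hY₂, hEq⟩

/-- **THE LOCAL TERM IS ZERO when the second class is `τ`-fixed and `2`-torsion modulo `m·𝓛`.**  Cassels–Tate level `m`, `m·m = 2^M`;
`λ ∋ ℓ` a deep inert Kolyvagin place (`Δ < 0`, `1 ≤ M ≤ M(ℓ)`, `FrobEqFrobInfty W K (2^M) ℓ`, `τ•λ = λ`; `e` lift-equivariant, `inv`
conj-compatible); a first-case datum `D` whose global lift `b₁` is a `τ_*`-eigenclass (sign `s = ±1`) with `m • loc_λ b₁ = 0` (own prime of
`z = m • b₁`) and whose Kummer lift `β′_λ` satisfies `σ_*β′_λ − β′_λ = m·Y₁`, `2β′_λ = m·Y₂` (`Y₁, Y₂ ∈ 𝓛_λ`).  Then `t_λ(D) = 0`.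
[cite: McCallumLMS1991, §4 Prop. 4.7, §5 Lemma 5.3] -/
theorem firstCase_localTerm_eq_zero_of_bottomLayer {m M : ℕ} [NeZero m] [NeZero (m * m)] (hmm : m * m = 2 ^ M)
    (hK : IsImaginaryQuadratic K) (hΔ : W.Δ < 0) {ℓ : ℕ} (hM : 1 ≤ M)
    (hℓ : Zhang2014.IsKolyvaginPrime (W.conductorNorm ℤ) W K 2 ℓ) (hk : M ≤ Zhang2014.kolyvaginIndex W 2 ℓ)
    (hF : FrobEqFrobInfty W K (2 ^ M) ℓ) (w : HeightOneSpectrum (𝓞 K)) (hw : (ℓ : 𝓞 K) ∈ w.asIdeal)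
    {τ : K ≃ₐ[ℚ] K} (hτ1 : τ ≠ 1) (hττ : τ * τ = 1) (hfix : τ • w = w)
    (e : (W.baseChange K).geomTorsion ((m * m : ℕ) : ℤ) → (W.baseChange K).geomTorsion ((m * m : ℕ) : ℤ) → AlgebraicClosure K)
    (hμ : ∀ S T, e S T ^ (m * m) = 1)
    (hadd₁ : ∀ S₁ S₂ T, e (S₁ + S₂) T = e S₁ T * e S₂ T)
    (hadd₂ : ∀ S T₁ T₂, e S (T₁ + T₂) = e S T₁ * e S T₂)
    (hgal : ∀ (γ : absoluteGaloisGroup K) (S T : (W.baseChange K).geomTorsion ((m * m : ℕ) : ℤ)), γ • e S T = e (γ • S) (γ • T))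
    (halt : ∀ T, e T T = 1)
    (hte : ∀ S T, e ((isLiftOfAut_liftAutPlace τ hfix).torsionMap W ((m * m : ℕ) : ℤ) S)
      ((isLiftOfAut_liftAutPlace τ hfix).torsionMap W ((m * m : ℕ) : ℤ) T) = liftAutPlace τ hfix (e S T))
    (inv : LocalInvariants K (m * m)) (hinvc : inv.IsConjCompatible τ)
    (D : FirstCaseData (W.baseChange K) m) {s : ℤ} (hs : s = 1 ∨ s = -1)
    (hb₁ : conjAct W τ ((m * m : ℕ) : ℤ) D.b₁ = s • D.b₁)
    (hmb₁ : (m : ℤ) • galoisCohomology.localization ((W.baseChange K).torsionGaloisModule ((m * m : ℕ) : ℤ)) (Sum.inr w : Place K) 1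
      D.b₁ = 0)
    {βw Y₁ Y₂ : galoisCohomology (((W.baseChange K).torsionGaloisModule ((m * m : ℕ) : ℤ)).toLocal (Sum.inr w : Place K)) 1}
    (hβw : βw = D.β' (Sum.inr w))
    (hY₁ : Y₁ ∈ (W.baseChange K).kummerSelmerStructure ((m * m : ℕ) : ℤ) (Sum.inr w))
    (hY₂ : Y₂ ∈ (W.baseChange K).kummerSelmerStructure ((m * m : ℕ) : ℤ) (Sum.inr w))
    (hσβ' : conjActPlace W τ ((m * m : ℕ) : ℤ) hfix βw - βw = (m : ℤ) • Y₁) (h2β' : (2 : ℤ) • βw = (m : ℤ) • Y₂) :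
    D.localTerm e hμ hadd₁ hadd₂ hgal inv (Sum.inr w) = 0 := by
  have hβmem : βw ∈ (W.baseChange K).kummerSelmerStructure ((m * m : ℕ) : ℤ) (Sum.inr w) := hβw ▸ D.β'_mem (Sum.inr w)
  rw [firstCase_localTerm_eq_invWeilPairing_localization e hμ hadd₁ hadd₂ hgal halt inv D (Sum.inr w)]
  have h := (invWeilPairing_kummer_localization_eq_zero_of_conjActPlace_sub_eq_zsmul_of_two_smul_of_level_eq W K hmm hK hΔ hM hℓ hk hF
    w hw hτ1 hττ hfix e hμ hadd₁ hadd₂ hgal halt hte inv hinvc hs hb₁ hmb₁ hβmem hY₁ hY₂ hσβ' h2β').2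
  rwa [hβw] at h

/-- **THE LOCAL TERM IS ZERO (bottom layer, hypotheses on the datum's second class).**  Same frame; `D.b′` `τ`-invariant
(`τ_* b′ = b′`) and `2`-torsion (`2·b′ = 0`), `b₁` a `τ_*`-eigenclass with `m • loc_λ b₁ = 0` ⟹ `t_λ(D) = 0`.
[cite: McCallumLMS1991, §4 Prop. 4.7, §5 Lemma 5.3] -/
theorem firstCase_localTerm_eq_zero_of_bottomLayer_of_conjAct_eq {m M : ℕ} [NeZero m] [NeZero (m * m)] (hmm : m * m = 2 ^ M)
    (hK : IsImaginaryQuadratic K) (hΔ : W.Δ < 0) {ℓ : ℕ} (hM : 1 ≤ M)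
    (hℓ : Zhang2014.IsKolyvaginPrime (W.conductorNorm ℤ) W K 2 ℓ) (hk : M ≤ Zhang2014.kolyvaginIndex W 2 ℓ)
    (hF : FrobEqFrobInfty W K (2 ^ M) ℓ) (w : HeightOneSpectrum (𝓞 K)) (hw : (ℓ : 𝓞 K) ∈ w.asIdeal)
    {τ : K ≃ₐ[ℚ] K} (hτ1 : τ ≠ 1) (hττ : τ * τ = 1) (hfix : τ • w = w)
    (e : (W.baseChange K).geomTorsion ((m * m : ℕ) : ℤ) → (W.baseChange K).geomTorsion ((m * m : ℕ) : ℤ) → AlgebraicClosure K)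
    (hμ : ∀ S T, e S T ^ (m * m) = 1)
    (hadd₁ : ∀ S₁ S₂ T, e (S₁ + S₂) T = e S₁ T * e S₂ T)
    (hadd₂ : ∀ S T₁ T₂, e S (T₁ + T₂) = e S T₁ * e S T₂)
    (hgal : ∀ (γ : absoluteGaloisGroup K) (S T : (W.baseChange K).geomTorsion ((m * m : ℕ) : ℤ)), γ • e S T = e (γ • S) (γ • T))
    (halt : ∀ T, e T T = 1)
    (hte : ∀ S T, e ((isLiftOfAut_liftAutPlace τ hfix).torsionMap W ((m * m : ℕ) : ℤ) S)
      ((isLiftOfAut_liftAutPlace τ hfix).torsionMap W ((m * m : ℕ) : ℤ) T) = liftAutPlace τ hfix (e S T))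
    (inv : LocalInvariants K (m * m)) (hinvc : inv.IsConjCompatible τ)
    (D : FirstCaseData (W.baseChange K) m) {s : ℤ} (hs : s = 1 ∨ s = -1)
    (hb₁ : conjAct W τ ((m * m : ℕ) : ℤ) D.b₁ = s • D.b₁)
    (hmb₁ : (m : ℤ) • galoisCohomology.localization ((W.baseChange K).torsionGaloisModule ((m * m : ℕ) : ℤ)) (Sum.inr w : Place K) 1
      D.b₁ = 0)
    (hb'τ : conjAct W τ (m : ℤ) D.b' = D.b') (hb'2 : (2 : ℤ) • D.b' = 0) :
    D.localTerm e hμ hadd₁ hadd₂ hgal inv (Sum.inr w) = 0 := by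
  -- `σ_*β′ − β′ = m·Y₁`: gk2-p4's lemma with `s = −1` (sign `−(−1) = +1`)
  have hb'' : conjAct W τ (m : ℤ) D.b' = -((-1 : ℤ) • D.b') := by rw [neg_one_zsmul, neg_neg]; exact hb'τ
  obtain ⟨Y₁, hY₁, hEq₁⟩ := exists_mem_kummer_conjActPlace_add_smul_eq_zsmul W K hfix D hb'' (D.β' (Sum.inr w)) rfl
  rw [neg_one_zsmul, ← sub_eq_add_neg] at hEq₁
  obtain ⟨Y₂, hY₂, hEq₂⟩ := exists_mem_kummer_two_smul_eq_zsmul W K w D hb'2 (D.β' (Sum.inr w)) rfl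
  exact firstCase_localTerm_eq_zero_of_bottomLayer W K hmm hK hΔ hM hℓ hk hF w hw hτ1 hττ hfix e hμ hadd₁ hadd₂ hgal halt hte inv hinvc D hs
    hb₁ hmb₁ rfl hY₁ hY₂ hEq₁ hEq₂

/-- **THE LOCAL TERM IS ZERO (bottom layer, hypotheses on `t = ι_* b′`).**  As `firstCase_localTerm_eq_zero_of_bottomLayer_of_conjAct_eq`, with
the second class given as `t := ι_* D.b′ ∈ H¹(K, E[m²])`, `τ_* t = t`, `2·t = 0`, and `E[m]` without non-zero `Γ_K`-fixed points (so `ι_*` is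
injective and reflects signs). [cite: McCallumLMS1991, §4 Prop. 4.7] [cite: GrossLMS1991, §5 Prop. 5.4] -/
theorem firstCase_localTerm_eq_zero_of_bottomLayer_inclKD {m M : ℕ} [NeZero m] [NeZero (m * m)] (hmm : m * m = 2 ^ M)
    (hK : IsImaginaryQuadratic K) (hΔ : W.Δ < 0) {ℓ : ℕ} (hM : 1 ≤ M)
    (hℓ : Zhang2014.IsKolyvaginPrime (W.conductorNorm ℤ) W K 2 ℓ) (hk : M ≤ Zhang2014.kolyvaginIndex W 2 ℓ)
    (hF : FrobEqFrobInfty W K (2 ^ M) ℓ) (w : HeightOneSpectrum (𝓞 K)) (hw : (ℓ : 𝓞 K) ∈ w.asIdeal)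
    {τ : K ≃ₐ[ℚ] K} (hτ1 : τ ≠ 1) (hττ : τ * τ = 1) (hfix : τ • w = w)
    (e : (W.baseChange K).geomTorsion ((m * m : ℕ) : ℤ) → (W.baseChange K).geomTorsion ((m * m : ℕ) : ℤ) → AlgebraicClosure K)
    (hμ : ∀ S T, e S T ^ (m * m) = 1)
    (hadd₁ : ∀ S₁ S₂ T, e (S₁ + S₂) T = e S₁ T * e S₂ T)
    (hadd₂ : ∀ S T₁ T₂, e S (T₁ + T₂) = e S T₁ * e S T₂)
    (hgal : ∀ (γ : absoluteGaloisGroup K) (S T : (W.baseChange K).geomTorsion ((m * m : ℕ) : ℤ)), γ • e S T = e (γ • S) (γ • T))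
    (halt : ∀ T, e T T = 1)
    (hte : ∀ S T, e ((isLiftOfAut_liftAutPlace τ hfix).torsionMap W ((m * m : ℕ) : ℤ) S)
      ((isLiftOfAut_liftAutPlace τ hfix).torsionMap W ((m * m : ℕ) : ℤ) T) = liftAutPlace τ hfix (e S T))
    (inv : LocalInvariants K (m * m)) (hinvc : inv.IsConjCompatible τ)
    (hnofix : ∀ P : geomTorsion (W.baseChange K) (m : ℤ), (∀ g : absoluteGaloisGroup K, g • P = P) → P = 0)
    (D : FirstCaseData (W.baseChange K) m) {s : ℤ} (hs : s = 1 ∨ s = -1)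
    (hb₁ : conjAct W τ ((m * m : ℕ) : ℤ) D.b₁ = s • D.b₁)
    (hmb₁ : (m : ℤ) • galoisCohomology.localization ((W.baseChange K).torsionGaloisModule ((m * m : ℕ) : ℤ)) (Sum.inr w : Place K) 1
      D.b₁ = 0)
    {t : galoisCohomology ((W.baseChange K).torsionGaloisModule ((m * m : ℕ) : ℤ)) 1}
    (hDt : galoisCohomology.map (inclKD (W.baseChange K) m m) 1 D.b' = t) (htτ : conjAct W τ ((m * m : ℕ) : ℤ) t = t)
    (ht2 : (2 : ℤ) • t = 0) :
    D.localTerm e hμ hadd₁ hadd₂ hgal inv (Sum.inr w) = 0 := by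
  have htτ' : conjAct W τ ((m * m : ℕ) : ℤ) t = (1 : ℤ) • t := by rw [one_zsmul]; exact htτ
  have hb'τ : conjAct W τ (m : ℤ) D.b' = D.b' := by
    have h := conjAct_eq_smul_of_map_inclKD_eq W τ m hnofix hDt htτ'
    rwa [one_zsmul] at h
  have hb'2 : (2 : ℤ) • D.b' = 0 := by
    apply map_inclKD_injective_of_forall_fixed_eq_zero (W.baseChange K) m hnofix
    rw [map_zsmul, hDt, ht2, map_zero]
  exact firstCase_localTerm_eq_zero_of_bottomLayer_of_conjAct_eq W K hmm hK hΔ hM hℓ hk hF w hw hτ1 hττ hfix e hμ hadd₁ hadd₂ hgal halt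
    hte inv hinvc D hs hb₁ hmb₁ hb'τ hb'2

/-! ## §5 `B(x, y) = 0`: a Kolyvagin-provenance class against the bottom layer from `ℚ` -/

/-- `m · m = 2^M` with `M ≥ 1` forces `2 ∣ m`. [folklore] -/
theorem two_dvd_of_mul_self_eq_two_pow {m M : ℕ} (hmm : m * m = 2 ^ M) (hM : 1 ≤ M) : (2 : ℤ) ∣ (m : ℤ) := by
  have h2 : (2 : ℕ) ∣ m * m := by
    rw [hmm]; exact dvd_pow_self 2 (by omega)
  have h := (Nat.Prime.dvd_mul Nat.prime_two).mp h2
  exact_mod_cast h.elim id id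

/-- **THE BOTTOM LAYER FROM `ℚ` IS CASSELS–TATE ORTHOGONAL TO EVERY KOLYVAGIN-PROVENANCE CLASS (`ι`-free).**  Frame: `K` imaginary
quadratic, `τ ≠ 1`, `τ² = 1`; `E/ℚ` globally minimal with `Δ < 0`; Cassels–Tate level `m` with `m·m = 2^M`, `1 ≤ M`; `e`, `inv` the Weil pairing /
local invariants at level `m·m` (`e` alternating, lift-equivariant at the own places; `inv` conj-compatible); `E(K̄)[m]` without non-zero
`Γ_K`-fixed points.  Data: `x, y ∈ Ш(E/K)[m]` over Selmer classes `z = m • k • c` (eigen: `τ_*(k•c) = s·(k•c)`, `s = ±1`; `c` Selmer off the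
finite set `Sn` of own places, `m • loc_q(k•c) = 0` at `q ∈ Sn`, every `q ∈ Sn` a deep inert Kolyvagin place with `e` lift-equivariant there — the
PROVENANCE currency of gk2-p2's capstone / gk2-p5's adapter) and `t` with **`τ_* t = t` and `2 • t = 0`** (the BOTTOM LAYER FROM `ℚ`:
e.g. `t = res b`, `b ∈ H¹(ℚ, E[2]) ↪ H¹(K, E[m²])` Selmer over `K`; `y ∈ Z₀` of the seat memo).  Then **`B(x, y) = 0`**: McCallum's Prop. 4.7 as
a SUM of local terms, each zero — Kummer off `Sn`, BOTTOM-LAYER at `Sn` (§4).  With bilinearity (`forall_mem_closure_apply_eq_zero`) both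
Kolyvagin spans of LINE 18 are orthogonal to `Z₀`; no `K`-side certificate of McCallum's Thm. 5.4 / 5.8 detects `Z₀`.
[cite: McCallumLMS1991, §4 Prop. 4.7, §5 Lemma 5.3, Thm. 5.4, Thm. 5.8] [cite: MilneADT2006, Ch. I §6, Prop. 6.9] [cite: Kolyvagin1991StructureSha] -/
theorem ctLevelPairing_eq_zero_of_bottomLayer {m M : ℕ} [NeZero m] [NeZero (m * m)] (hmm : m * m = 2 ^ M)
    (hK : IsImaginaryQuadratic K) (hΔ : W.Δ < 0) (hM : 1 ≤ M) {τ : K ≃ₐ[ℚ] K} (hτ1 : τ ≠ 1) (hττ : τ * τ = 1)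
    (e : (W.baseChange K).geomTorsion ((m * m : ℕ) : ℤ) → (W.baseChange K).geomTorsion ((m * m : ℕ) : ℤ) → AlgebraicClosure K)
    (hμ : ∀ S T, e S T ^ (m * m) = 1)
    (hadd₁ : ∀ S₁ S₂ T, e (S₁ + S₂) T = e S₁ T * e S₂ T)
    (hadd₂ : ∀ S T₁ T₂, e S (T₁ + T₂) = e S T₁ * e S T₂)
    (hgal : ∀ (γ : absoluteGaloisGroup K) (S T : (W.baseChange K).geomTorsion ((m * m : ℕ) : ℤ)), γ • e S T = e (γ • S) (γ • T))
    (halt : ∀ T, e T T = 1)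
    (inv : LocalInvariants K (m * m)) (hinvc : inv.IsConjCompatible τ) (hPT' : inv.SumInvLocalizationEqZero)
    (hH3 : ∀ c₃ : galoisCohomology (DiscreteGaloisModule.mu K (m * m)) 3,
      (∀ v : Place K, galoisCohomology.localization (DiscreteGaloisModule.mu K (m * m)) v 3 c₃ = 0) → c₃ = 0)
    (hfin : ∀ D : GeneralCaseData (W.baseChange K) m e hμ hadd₁ hadd₂ hgal, ∃ S : Finset (Place K), ∀ v ∉ S, D.localTerm inv v = 0)
    (hnofix : ∀ P : geomTorsion (W.baseChange K) (m : ℤ), (∀ g : absoluteGaloisGroup K, g • P = P) → P = 0)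
    (x y : ((W.baseChange K).sha)[m]) (z t : selmerGroup (W.baseChange K) ((m * m : ℕ) : ℤ))
    (hx : shaTorsionVal (W.baseChange K) m x = torsionH1ToH1 (W.baseChange K) ((m * m : ℕ) : ℤ) z)
    (hy : shaTorsionVal (W.baseChange K) m y = torsionH1ToH1 (W.baseChange K) ((m * m : ℕ) : ℤ) t)
    (c : galoisCohomology ((W.baseChange K).torsionGaloisModule ((m * m : ℕ) : ℤ)) 1) (k : ℤ)
    (hz : (z : galH1Torsion (W.baseChange K) ((m * m : ℕ) : ℤ)) = (m : ℤ) • k • c)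
    {s : ℤ} (hs : s = 1 ∨ s = -1) (hsc : conjAct W τ ((m * m : ℕ) : ℤ) (k • c) = s • (k • c))
    (htτ : conjAct W τ ((m * m : ℕ) : ℤ) (t : galH1Torsion (W.baseChange K) ((m * m : ℕ) : ℤ)) =
      (t : galH1Torsion (W.baseChange K) ((m * m : ℕ) : ℤ)))
    (ht2 : (2 : ℤ) • (t : galH1Torsion (W.baseChange K) ((m * m : ℕ) : ℤ)) = 0)
    (Sn : Set (HeightOneSpectrum (𝓞 K)))
    (hc : ∀ v : Place K, (∀ q ∈ Sn, v ≠ Sum.inr q) → c ∈ selmerLocalKer (W.baseChange K) (Place.Completion v) ((m * m : ℕ) : ℤ))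
    (hmc : ∀ q ∈ Sn, (m : ℤ) • galoisCohomology.localization ((W.baseChange K).torsionGaloisModule ((m * m : ℕ) : ℤ))
      (Sum.inr q : Place K) 1 (k • c) = 0)
    (hdeep : ∀ q ∈ Sn, ∃ (ℓ : ℕ) (hfix : τ • q = q), Zhang2014.IsKolyvaginPrime (W.conductorNorm ℤ) W K 2 ℓ ∧
      M ≤ Zhang2014.kolyvaginIndex W 2 ℓ ∧ FrobEqFrobInfty W K (2 ^ M) ℓ ∧ (ℓ : 𝓞 K) ∈ q.asIdeal ∧
      ∀ S T, e ((isLiftOfAut_liftAutPlace τ hfix).torsionMap W ((m * m : ℕ) : ℤ) S)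
        ((isLiftOfAut_liftAutPlace τ hfix).torsionMap W ((m * m : ℕ) : ℤ) T) = liftAutPlace τ hfix (e S T)) :
    ctLevelPairing (W.baseChange K) m e hμ hadd₁ hadd₂ hgal inv halt hPT' hH3 hfin x y = 0 := by
  -- `m • t = 0` since `2 ∣ m` and `2 • t = 0`
  have hmt : (m : ℤ) • (t : galH1Torsion (W.baseChange K) ((m * m : ℕ) : ℤ)) = 0 := by
    obtain ⟨r, hr⟩ := two_dvd_of_mul_self_eq_two_pow hmm hM
    have hr' : (m : ℤ) = r * 2 := by rw [hr]; ring
    have h : (m : ℤ) • (t : galH1Torsion (W.baseChange K) ((m * m : ℕ) : ℤ)) =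
        r • ((2 : ℤ) • (t : galH1Torsion (W.baseChange K) ((m * m : ℕ) : ℤ))) := by
      rw [smul_smul, ← hr']
    rw [h, ht2, zsmul_zero]
  -- first-case data for the pair
  obtain ⟨D, hD₁, hDt⟩ := exists_firstCaseData_kolyvagin z t c k hz hnofix hmt
  refine ctLevelPairing_eq_zero_of_forall_cases e hμ hadd₁ hadd₂ hgal inv halt hPT' hH3 hfin x y z t hx hy hz D hD₁ hDt fun v ↦ ?_
  by_cases hv : ∃ q ∈ Sn, v = Sum.inr q
  · -- own place of `z`: the bottom-layer local term
    obtain ⟨q, hq, rfl⟩ := hv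
    obtain ⟨ℓ, hfix, hℓ, hk, hF, hw, hte⟩ := hdeep q hq
    refine Or.inr (Or.inr ?_)
    have hb₁ : conjAct W τ ((m * m : ℕ) : ℤ) D.b₁ = s • D.b₁ := by rw [hD₁]; exact hsc
    have hmb₁ : (m : ℤ) • galoisCohomology.localization ((W.baseChange K).torsionGaloisModule ((m * m : ℕ) : ℤ))
        (Sum.inr q : Place K) 1 D.b₁ = 0 := by rw [hD₁]; exact hmc q hq
    exact firstCase_localTerm_eq_zero_of_bottomLayer_inclKD W K hmm hK hΔ hM hℓ hk hF q hw hτ1 hττ hfix e hμ hadd₁ hadd₂ hgal halt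
      hte inv hinvc hnofix D hs hb₁ hmb₁ hDt htτ ht2
  · -- `b₁` is Selmer (Kummer) here
    push Not at hv
    refine Or.inl ?_
    have hcv : c ∈ selmerLocalKer (W.baseChange K) (Place.Completion v) ((m * m : ℕ) : ℤ) := hc v fun q hq h ↦ hv q hq h
    rw [map_zsmul]
    exact AddSubgroup.zsmul_mem _ (mem_kummerLocalConditionAt_res_of_mem_selmerLocalKer (W.baseChange K) _ _ hcv) k

end Kolyvagin

end Summit.BirchSwinnertonDyer.BirchSwinnertonDyer.Theorems.GenusExact.PlusDescent

end
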